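import Summits.CriticalPhenomena.PercolationContinuityZ3.Theorems.Transplant.KNCells2Scheme
import Summits.CriticalPhenomena.PercolationContinuityZ3.Theorems.Transplant.KNCellsStepsSubbox
import Summits.CriticalPhenomena.PercolationContinuityZ3.Theorems.Transplant.KNLevelsTargetChain
import HarnessLib

/-!
# F8 (generic, LAG-1 ANCHORS) — the CORRIDOR INPUT `hreach` of `fail_bound₂` / `samePWitnessAt_of_cellKit₂` from a CHAIN OF TARGET STEPS
# (Kozma–Nitzan's Lemma 12 over cells: `KNLevels.TargetProperty.chain`, stmt's engine p212753, run under the weighting `μ` of Step IV restricted to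
# the corridor region `U = E_i ∪ E^α_{v,x} ∪ H^β_{x,y}`; design HOME/prim-bschramm-p2-g2/F8-DESIGN.md §7)

builds on p205010 (kernel theorem, internal audit signed; external expert review pending) — nothing in this file uses p205010.
Lane `prim-bschramm`, seat `prim-bschramm-p2` (Corridor-over-levels, lead 10:50Z); helper file (`--supports stmt-CriticalPhenomena-4575`).

KN (p. 30): "by Lemma 12 … `P(0 ↔ M_x in E_i ∪ E_{w,v} ∪ H_{v,x}) > 1 - ε'`".  With both anchors fixed by the history the weighting is
`μ = Wfull h e α β du` (graph weights pinned on `ω|_{E_i}`, restricted to `E_i ∪ E^α_{v,x} ∪ E^β_{x,y}`), and Lemma 12 = a chain of target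
steps (`TStep`s with kits, instance geometry) under `μ` further restricted to `U` (so that `openConn` under it is `↔ inside U`):
* `Ucor`, `Wcor = restrW U μ`; `finSupp_Wcor`, **`isSubbox_Wcor`** (every `Dd ⊆ U ∩ (E_i ∪ E_{v,x} ∪ E_{x,y})` disjoint from `E_i` is a subbox:
  only the edges of `E_i` are pinned), `Wcor_apply_of_mem`;
* **`lt_real_reachB_Wcor`** — the SOURCE of the chain: (32) (`Valid₂.reach`: `1 - δc < P_{W₀}(root ↔ M^α_x)`) gives
  `1 - δc < P_{Wcor}(root ↔ X₀(0))` for every first level `X₀(0) ⊇ M^α_x`;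
* **`hreach_of_chain`** — a linked chain of `n + 1` steps with source `root`, kits at the accuracy `δ` of `TargetProperty.chain` (with `δc ≤ δ`),
  first core `⊇ M^α_x` and last target `M^β_{x+du}`, gives `1 - ε'' < P_μ(Reach h e α β du)` — the hypothesis `hreach` of `fail_bound₂`.
[cite: KozmaNitzan2024, §4 Lemma 12 (pp. 23–25), p. 30 (Step IV, first claim) — the ℤ^d model] [cite: GrimmettPercolation1999, §7.2]
-/

noncomputable section

open MeasureTheory ProbabilityTheory
open scoped ENNReal Classical

namespace Summit.CriticalPhenomena.PercolationContinuityZ3.Theorems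

namespace Transplant

namespace KNCells

open Literature.Probability.Percolation Literature.Probability.LatticeModels SimpleGraph GadgetSystem ProbeHistory HSiteScheme Contour

variable {V : Type*} [DecidableEq V]

namespace KSchA

variable {A : Type*} (G : SimpleGraph V) [G.LocallyFinite] (S : KSchA V A) (FD : FaceData V A)

/-- **The corridor region** `U = E_i ∪ E^α_{v,x} ∪ H^β_{x,y}`. [cite: KozmaNitzan2024, §4 p. 30] -/
def Ucor (h : ProbeHistory V) (e : Site 2 × MDir) (a a' : A) (du : MDir) : Finset V :=
  S.Vx G h ∪ S.Γ.Ewv a e.1 e.2 ∪ FD.Hfull a' (tgt e) du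

/-- **The corridor weighting**: `μ = Wfull h e α β du` restricted to the pairs inside `U`. [cite: KozmaNitzan2024, §4 p. 30] -/
def Wcor (h : ProbeHistory V) (e : Site 2 × MDir) (a a' : A) (du : MDir) : Sym2 V → unitInterval :=
  restrW (↑(S.Ucor G FD h e a a' du) : Set V) (S.Wfull G h e a a' du)

variable {G S FD}
variable {h : ProbeHistory V} {e : Site 2 × MDir} {a a' : A} {du : MDir}

/-- `Wcor` is finitely supported on `E_i ∪ E_{v,x} ∪ E_{x,y}`. [folklore] -/
theorem finSupp_Wcor : KNLevels.FinSupp (S.Wcor G FD h e a a' du) (S.Sx G h e a a' du) := by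
  refine ⟨fun x hx => ?_⟩
  unfold Wcor
  by_cases hxU : x ∈ wireSet (↑(S.Ucor G FD h e a a' du) : Set V)
  · rw [restrW_apply_of_mem _ hxU]
    unfold Wfull
    refine restrW_apply_of_not_mem _ fun hxS => ?_
    obtain ⟨y, hy, hyS⟩ := hx
    exact hyS (Finset.mem_coe.1 (hxS.1 y hy))
  · exact restrW_apply_of_not_mem _ hxU

/-- `Wcor` is also finitely supported on the corridor region. [folklore] -/
theorem finSupp_Wcor_U : KNLevels.FinSupp (S.Wcor G FD h e a a' du) (S.Ucor G FD h e a a' du) := by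
  unfold Wcor; exact finSupp_restrW _ _

/-- On a pair inside `U ∩ (E_i ∪ E_{v,x} ∪ E_{x,y})` which is not an explored edge, `Wcor` is the graph weighting. [folklore] -/
theorem Wcor_apply_of_mem {x : Sym2 V} (hxU : x ∈ wireSet (↑(S.Ucor G FD h e a a' du) : Set V))
    (hxS : x ∈ wireSet (↑(S.Sx G h e a a' du) : Set V)) (hxF : x ∉ S.F G h) :
    S.Wcor G FD h e a a' du x = KNLevels.lattW G S.p x := by
  unfold Wcor Wfull
  rw [restrW_apply_of_mem _ hxU, restrW_apply_of_mem _ hxS, pinW_apply_of_not_mem _ _ (fun h' => hxF (Finset.mem_coe.1 h'))]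

/-- **`Wcor` is a subbox weighting on every `Dd ⊆ U ∩ (E_i ∪ E_{v,x} ∪ E_{x,y})` disjoint from the explored region** (valid history: the pinned
edges are the edges of `E_i`). [cite: KozmaNitzan2024, §4 p. 31 (D is a subbox of Ω)] -/
theorem isSubbox_Wcor (hF : S.F G h = edgesIn G (S.Vx G h)) {Dd : Finset V} (hD : Dd ⊆ S.Sx G h e a a' du)
    (hDU : Dd ⊆ S.Ucor G FD h e a a' du) (hdis : Disjoint Dd (S.Vx G h)) :
    KNLevels.IsSubbox G (S.Wcor G FD h e a a' du) S.p Dd := by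
  have hfresh : ∀ u ∈ Dd, ∀ z, s(u, z) ∉ S.F G h := fun u hu z h' => by
    rw [hF, mem_edgesIn_iff] at h'
    exact Finset.disjoint_left.1 hdis hu (h'.2 u (Sym2.mem_mk_left _ _))
  refine ⟨fun u hu v hv huv => ?_, fun u hu v hv hne huv => ?_, fun v hv hvb x hx => ?_⟩
  · rw [Wcor_apply_of_mem (mk_mem_wireSet_iff.2 ⟨Finset.mem_coe.2 (hDU hu), Finset.mem_coe.2 (hDU hv), huv.ne⟩)
      (mk_mem_wireSet_iff.2 ⟨Finset.mem_coe.2 (hD hu), Finset.mem_coe.2 (hD hv), huv.ne⟩) (hfresh u hu v),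
      KNLevels.lattW_apply, if_pos ((SimpleGraph.mem_edgeSet G).2 huv)]
  · rw [Wcor_apply_of_mem (mk_mem_wireSet_iff.2 ⟨Finset.mem_coe.2 (hDU hu), Finset.mem_coe.2 (hDU hv), hne⟩)
      (mk_mem_wireSet_iff.2 ⟨Finset.mem_coe.2 (hD hu), Finset.mem_coe.2 (hD hv), hne⟩) (hfresh u hu v),
      KNLevels.lattW_apply, if_neg (fun h' => huv ((SimpleGraph.mem_edgeSet G).1 h'))]
  · have hnadj : ¬G.Adj x v := fun hadj => hvb (mem_innerBoundary_iff.2 ⟨hv, x, hx, hadj.symm⟩)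
    by_cases hxU : s(x, v) ∈ wireSet (↑(S.Ucor G FD h e a a' du) : Set V)
    · by_cases hxS : s(x, v) ∈ wireSet (↑(S.Sx G h e a a' du) : Set V)
      · rw [Sym2.eq_swap] at hxU hxS
        rw [Sym2.eq_swap, Wcor_apply_of_mem hxU hxS (hfresh v hv x), KNLevels.lattW_apply,
          if_neg (fun h' => hnadj ((SimpleGraph.mem_edgeSet G).1 h').symm)]
      · unfold Wcor Wfull
        rw [restrW_apply_of_mem _ hxU, restrW_apply_of_not_mem _ hxS]
    · unfold Wcor; exact restrW_apply_of_not_mem _ hxU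

variable [Countable V]

/-- **The source of the chain**: after a valid history, `1 - δc < P_{Wcor}(root ↔ B)` for every `B ⊇ M^α_x` — (32) read inside
`E_i ∪ E^α_{v,x} ⊆ U`, where `Wcor` and `W₀` agree. [cite: KozmaNitzan2024, §4 p. 28 ((32)), p. 30] -/
theorem lt_real_reachB_Wcor (hV : S.Valid₂ G h e) (hroot : S.Γ.root ∈ S.Ucor G FD h e (S.aOf₁ G h e) a' du)
    {B : Finset V} (hB : S.Γ.M (S.aOf₁ G h e) (tgt e) ⊆ B) :
    1 - S.δc < (prodBernoulli (S.Wcor G FD h e (S.aOf₁ G h e) a' du)).real (⋃ b ∈ B, openConn S.Γ.root b) := by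
  set α := S.aOf₁ G h e with hα
  set D := S.Vx G h ∪ S.Γ.Ewv α e.1 e.2 with hD
  have h0 : S.Γ.root ∈ (↑D : Set V) := Finset.mem_coe.2 (Finset.mem_union_left _ hV.root_mem)
  -- (32) inside `E_i ∪ E_{v,x}`
  have h32 : 1 - S.δc < (prodBernoulli (pinW (KNLevels.lattW G S.p) ↑(S.F G h) ↑(S.ξ G h))).real
      (⋃ t ∈ (↑(S.Γ.M α (tgt e)) : Set V), openConnIn (↑D : Set V) S.Γ.root t) := by
    have := hV.reach
    rw [W₀, ← Finset.set_biUnion_coe, prodBernoulli_restrW_real_biUnion_openConn _ _ h0] at this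
    exact this
  -- the same event under `Wcor`
  have hsubU : (↑D : Set V) ⊆ ↑(S.Ucor G FD h e α a' du) := Finset.coe_subset.2 Finset.subset_union_left
  have hsubS : (↑D : Set V) ⊆ ↑(S.Sx G h e α a' du) := Finset.coe_subset.2 Finset.subset_union_left
  have heq : ∀ x ∈ wireSet (↑D : Set V), S.Wcor G FD h e α a' du x = pinW (KNLevels.lattW G S.p) ↑(S.F G h) ↑(S.ξ G h) x := by
    intro x hx
    unfold Wcor Wfull
    rw [restrW_apply_of_mem _ (KozmaNitzan.wireSet_mono hsubU hx), restrW_apply_of_mem _ (KozmaNitzan.wireSet_mono hsubS hx)]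
  have h1 : (prodBernoulli (S.Wcor G FD h e α a' du)).real (⋃ t ∈ (↑(S.Γ.M α (tgt e)) : Set V), openConnIn (↑D : Set V) S.Γ.root t) =
      (prodBernoulli (pinW (KNLevels.lattW G S.p) ↑(S.F G h) ↑(S.ξ G h))).real
        (⋃ t ∈ (↑(S.Γ.M α (tgt e)) : Set V), openConnIn (↑D : Set V) S.Γ.root t) :=
    prodBernoulli_real_eq_of_determinedBy _ _ heq (determinedBy_biUnion_openConnIn _ _ _ subset_rfl) (measurableSet_biUnion_openConnIn _ _ _)
  have h2 : (⋃ t ∈ (↑(S.Γ.M α (tgt e)) : Set V), openConnIn (↑D : Set V) S.Γ.root t) ⊆ ⋃ b ∈ B, openConn S.Γ.root b := by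
    refine (biUnion_openConnIn_subset_biUnion_openConn _ _ _).trans ?_
    intro ω hω
    simp only [Set.mem_iUnion, exists_prop, Finset.mem_coe] at hω ⊢
    obtain ⟨t, ht, hωt⟩ := hω
    exact ⟨t, hB ht, hωt⟩
  have _ := hroot
  calc 1 - S.δc < _ := h32
    _ = _ := h1.symm
    _ ≤ _ := measureReal_mono h2 (measure_ne_top _ _)

/-- **LEMMA 12 OVER CELLS ⟹ `hreach`.**  After a valid history, at the history anchors `(α, β)` and an onward direction `du`: a chain of
`n + 1` target steps `s₀, …, s_n` with source `root`, linked (`T_i ⊆ X_{i+1}(0)`), all with kits at accuracy `δ` under the corridor weighting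
`Wcor`, first core containing `M^α_x`, last target `M^β_{x+du}`, where `δ` is the accuracy of `TargetProperty.chain` at `(ε'', n)` and `δc ≤ δ`,
yields `1 - ε'' < P_μ(Reach h e α β du)`. [cite: KozmaNitzan2024, §4 Lemma 12 (pp. 23–25), p. 30 (Step IV)] -/
theorem hreach_of_chain (hV : S.Valid₂ G h e) {Δ : ℕ} {δ ε'' : ℝ} {n : ℕ} (hδc : S.δc ≤ δ)
    (hchain : ∀ (W : Sym2 V → unitInterval) (s : Fin (n + 1) → KNLevels.TStep G),
      (∀ i : Fin (n + 1), (s i).L.o = (s 0).L.o) →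
      (∀ i : Fin n, (s (Fin.castSucc i)).T ⊆ (s i.succ).L.X 0) →
      (∀ i : Fin (n + 1), (s i).KitsAt W S.p Δ δ) →
      1 - δ < (prodBernoulli W).real (s 0).L.reachB →
        1 - ε'' < (prodBernoulli W).real (⋃ t ∈ (s (Fin.last n)).T, openConn (s 0).L.o t))
    (s : Fin (n + 1) → KNLevels.TStep G) (ho : ∀ i : Fin (n + 1), (s i).L.o = S.Γ.root)
    (hlink : ∀ i : Fin n, (s (Fin.castSucc i)).T ⊆ (s i.succ).L.X 0)
    (hkits : ∀ i : Fin (n + 1), (s i).KitsAt (S.Wcor G FD h e (S.aOf₁ G h e) a' du) S.p Δ δ)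
    (hB0 : S.Γ.M (S.aOf₁ G h e) (tgt e) ⊆ (s 0).L.X 0) (hTn : (s (Fin.last n)).T = S.Γ.M a' (tgt e + stepVec du)) :
    1 - ε'' < (prodBernoulli (S.Wfull G h e (S.aOf₁ G h e) a' du)).real (S.Reach G FD h e (S.aOf₁ G h e) a' du) := by
  set α := S.aOf₁ G h e with hα
  have hroot : S.Γ.root ∈ S.Ucor G FD h e α a' du := Finset.mem_union_left _ (Finset.mem_union_left _ hV.root_mem)
  have ho' : ∀ i : Fin (n + 1), (s i).L.o = (s 0).L.o := fun i => by rw [ho i, ho 0]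
  have hsrc : 1 - δ < (prodBernoulli (S.Wcor G FD h e α a' du)).real (s 0).L.reachB := by
    have := lt_real_reachB_Wcor hV hroot hB0 (a' := a') (du := du)
    rw [KNLevels.LData.reachB, ho 0]
    linarith
  have hc := hchain _ s ho' hlink hkits hsrc
  rw [hTn, ho 0, Wcor, ← Finset.set_biUnion_coe, prodBernoulli_restrW_real_biUnion_openConn _ _ (Finset.mem_coe.2 hroot)] at hc
  exact hc

end KSchA

end KNCells

end Transplant

end Summit.CriticalPhenomena.PercolationContinuityZ3.Theorems

end
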